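import Summits.BirchSwinnertonDyer.BirchSwinnertonDyer.Theorems.ByReductionTypeAtTwoOrdKatoHalfAtTwoIsoKerCyclotomicTransposition
import HarnessLib

/-!
# Route ByReductionTypeAtTwo, crux `OrdKatoHalfAtTwoIso` (stmt-BirchSwinnertonDyer-19573), child B8
# `OrdKatoIntSurjectiveAtTwo` (stmt-BirchSwinnertonDyer-23762): Rubin's `τ` at `p = 2` — a TRANSPOSITION of `E[2]` in
# `Gal(ℚ̄/ℚ_∞^{cyc}(i)) = Gal(ℚ̄/ℚ(μ_{2^∞}))` on B8's habitat (`ρ_{W,2^∞}` onto), either sign of `Δ`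

Seat `cruxlead-stmt-BirchSwinnertonDyer-19573-w2` (prover WIDTH under the LEAD cruxlead-19573 g4, line
`steinberg-fibre-at-two`; HOME `run/shared/lean/pub/bsd-2adic/`; `--supports` stmt-BirchSwinnertonDyer-23762). HONEST FRAMING
(cell bsd-2adic): BSD is not proved by any of this; neither the crux nor the child B8 is proved here; theorems only (no
definition, no named fact, no `sorry`).

WHAT AND WHY. p681344 gave, for the cyclotomic `κ` and `2Δ ∉ ℚ^{×2}`, a transposition of `E[2]` inside `ker κ = Gal(ℚ̄/ℚ_∞)`
(the sign-free replacement of complex conjugation in socket 1's H-C, p681540). B8's `0 < Δ` half still owes (H-K) at the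
real place (p682357/p682426 display it): there the Kolyvagin primes must in addition be `≡ 1 (mod 4)` (real quadratic
Kolyvagin field `ℚ(√q)`; W_K2 Lemma 2.1 (d) / Rubin's hypothesis `Hyp(ℚ_∞, T₂E)` (b): an element of `Gal(ℚ̄/ℚ(μ_{2^∞}))`
with `T/(τ − 1)T` free of rank one — a transposition modulo `2`), i.e. their Frobenius must be a transposition lying in
`ker κ` AND fixing `i = √−1`. This file supplies that element:

* §1 two bookkeeping lemmas on the index-`2` subgroup `Gal(ℚ̄/ℚ_1) = κ⁻¹(2ℤ₂)`: an element `x ∈ ℚ̄` fixed by `Gal(ℚ̄/ℚ_1)`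
  and moved at most to `−x` is either `Γ_ℚ`-fixed or negated by everything off `Gal(ℚ̄/ℚ_1)`
  (`smul_eq_self_or_smul_eq_neg_of_layer_one`); `Gal(ℚ̄/ℚ_1) ≠ Γ_ℚ` (`exists_not_mem_layerSubgroup_one`).
* §2 `exists_mem_kerSubgroup_transposition_smul_sqrt_neg_one_eq` — **for `κ` cyclotomic, `ρ̄_{W,2}` onto and
  `2Δ, −Δ, −2Δ ∉ ℚ^{×2}`, some `τ ∈ ker κ` is a transposition on `E[2]` AND fixes `i`** (`i² = −1`). Proof: otherwise the
  two quadratic characters `sgn ∘ ρ̄₂` and `g ↦ g(i)/i` agree on `ker κ`, hence on `Gal(ℚ̄/ℚ_1) = ker κ · Γ_ℚ²`; by §1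
  applied to `iδ` (`δ = √(Δ/16)`) either `iδ ∈ ℚ` (`−Δ ∈ ℚ^{×2}`) or `iδ` is negated off `Gal(ℚ̄/ℚ_1)`, and then `iδ√2`
  is rational (`√2` is negated off `Gal(ℚ̄/ℚ_1)`, `ℚ_1 = ℚ(√2)`), i.e. `−2Δ ∈ ℚ^{×2}`.
* §3 `…_of_goodOrd_of_surjective_mod_four` — on B8's habitat: good ordinary at `2` (`Δ` odd ⇒ `±2Δ ∉ ℚ^{×2}`,
  `not_isSquare_two_mul_Δ_of_good_two`) and `ρ̄_{W,4}` onto (⇔ `ρ̄₂` onto ∧ `−Δ ∉ ℚ^{×2}`, Dokchitser–Dokchitser (2) at a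
  good ordinary `2`, `hasSurjectiveModNGaloisRep_four_iff_of_goodOrd_two`; `ρ̄_{W,4}` onto is level `n = 2` of
  `X5.O1.TwoAdicSurjective W`). On the DD12 residue (`−Δ ∈ ℚ^{×2}`, `ℚ(i) = ℚ(√Δ) ⊂ ℚ(E[2])`) no such `τ` exists — this is
  where B8's `2`-adic-image hypothesis is load-bearing (cell MEMO-5 V10 / MEMO-6 §5 (c)).

References: K. Rubin, *Euler Systems* (2000) §2.1 `Hyp(K_∞, T)` and Thm. 2.3.3 [Rubin2000]; T. Dokchitser, V. Dokchitser,
Math. Z. 272 (2012) [DokchitserDokchitserMathZ2012]; L. C. Washington (1997) §13.1 [Washington1997]; reserve wall W_K2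
Lemma 2.1 (d) and MEMO-6 §5 (HOME); p681344.
-/

set_option autoImplicit false
set_option linter.dupNamespace false

noncomputable section

open Field WeierstrassCurve Function
open Literature.NumberTheory.EllipticCurves Literature.NumberTheory.GaloisRepresentations
open Literature.NumberTheory.EllipticCurves.DokchitserDokchitser2012
open Summit.BirchSwinnertonDyer.BirchSwinnertonDyer.Rank1Residual

-- D-0017: single-problem summit, so `Summit.BirchSwinnertonDyer.BirchSwinnertonDyer.…` repeats a namespace BY DESIGN.
namespace Summit.BirchSwinnertonDyer.BirchSwinnertonDyer.Theorems.SteinbergFibreAtTwo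

/-! ## §1 Bookkeeping on the index-`2` subgroup `Gal(ℚ̄/ℚ_1)` -/

section LayerOne

variable (κ : ZpExtension ℚ 2)

/-- **`Gal(ℚ̄/ℚ_1) ≠ Γ_ℚ`**: some `σ ∈ Γ_ℚ` is not in the first layer (`κ` is onto `ℤ₂` and `2 ∤ 1`).
[cite: Washington1997, §13.1] -/
theorem exists_not_mem_layerSubgroup_one : ∃ σ : absoluteGaloisGroup ℚ, σ ∉ κ.layerSubgroup 1 := by
  obtain ⟨σ, hσ⟩ := κ.surjective (Multiplicative.ofAdd 1)
  rw [ZpExtension.coe_toContinuousMonoidHom] at hσ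
  refine ⟨σ, fun h => ?_⟩
  rw [ZpExtension.mem_layerSubgroup, hσ, toAdd_ofAdd, pow_one] at h
  exact (PadicInt.irreducible_p (p := 2)).not_isUnit (isUnit_iff_dvd_one.mpr h)

/-- **An element of `ℚ̄` fixed by `Gal(ℚ̄/ℚ_1)` and moved by every `g ∈ Γ_ℚ` at most to its negative is either
`Γ_ℚ`-fixed or negated by every element off `Gal(ℚ̄/ℚ_1)`** (the first layer has index `2`:
`mul_mem_layerSubgroup_one_of_not_mem`). [cite: Washington1997, §13.1] -/
theorem smul_eq_self_or_smul_eq_neg_of_layer_one {x : AlgebraicClosure ℚ}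
    (hL : ∀ g ∈ κ.layerSubgroup 1, g • x = x)
    (hpm : ∀ g : absoluteGaloisGroup ℚ, g • x = x ∨ g • x = -x) :
    (∀ g : absoluteGaloisGroup ℚ, g • x = x) ∨
      ∀ g : absoluteGaloisGroup ℚ, g ∉ κ.layerSubgroup 1 → g • x = -x := by
  by_cases hall : ∀ g : absoluteGaloisGroup ℚ, g • x = x
  · exact Or.inl hall
  right
  push Not at hall
  obtain ⟨σ, hσ⟩ := hall
  have hσL : σ ∉ κ.layerSubgroup 1 := fun h => hσ (hL σ h)
  have hσx : σ • x = -x := (hpm σ).resolve_left hσ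
  have hinv : σ⁻¹ • x = -x := by
    have h := congrArg (fun y => σ⁻¹ • y) hσx
    simp only [inv_smul_smul, smul_neg] at h
    rw [← neg_eq_iff_eq_neg] at h
    exact h.symm
  intro g hg
  calc g • x = (g * σ * σ⁻¹) • x := by rw [mul_inv_cancel_right]
    _ = (g * σ) • σ⁻¹ • x := mul_smul _ _ _
    _ = -x := by rw [hinv, smul_neg, hL _ (mul_mem_layerSubgroup_one_of_not_mem κ hg hσL)]

/-- **A `Γ_ℚ`-fixed element of `ℚ̄` is rational** (`ℚ̄/ℚ` is Galois), as a rational cast. [folklore] -/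
theorem exists_ratCast_eq_of_forall_smul_eq {x : AlgebraicClosure ℚ}
    (h : ∀ g : absoluteGaloisGroup ℚ, g • x = x) : ∃ q : ℚ, (q : AlgebraicClosure ℚ) = x := by
  obtain ⟨q, hq⟩ := (InfiniteGalois.mem_range_algebraMap_iff_fixed x).mpr fun g => h g
  rw [eq_ratCast] at hq
  exact ⟨q, hq⟩

/-- For the CYCLOTOMIC `κ`: an element `t` with `t² = 2` is negated by every element off `Gal(ℚ̄/ℚ_1)` (it is fixed by
`Gal(ℚ̄/ℚ_1)`, `ℚ_1 = ℚ(√2)`, and not rational). [cite: Washington1997, §13.1] -/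
theorem exists_sqrt_two_smul_eq_neg_of_isCyclotomic (hκ : κ.IsCyclotomic) :
    ∃ t : AlgebraicClosure ℚ, t ^ 2 = 2 ∧ (∀ g ∈ κ.layerSubgroup 1, g • t = t) ∧
      ∀ g : absoluteGaloisGroup ℚ, g ∉ κ.layerSubgroup 1 → g • t = -t := by
  obtain ⟨⟨t, htmem⟩, ht2⟩ := ZpExtension.IsCyclotomic.exists_sq_eq_two_layer_one hκ
  have ht2' : t ^ 2 = 2 := by
    have h := congrArg (algebraMap (κ.layer 1) (AlgebraicClosure ℚ)) ht2
    rw [map_pow, map_ofNat] at h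
    exact h
  have htfix : ∀ σ ∈ κ.layerSubgroup 1, σ • t = t := by
    intro σ hσ
    change t ∈ IntermediateField.fixedField _ at htmem
    rw [IntermediateField.mem_fixedField_iff] at htmem
    exact htmem _ (Subgroup.mem_map_of_mem _ hσ)
  have h2fix : ∀ σ : absoluteGaloisGroup ℚ, σ • (2 : AlgebraicClosure ℚ) = 2 := fun σ => by
    rw [show (2 : AlgebraicClosure ℚ) = algebraMap ℚ (AlgebraicClosure ℚ) 2 from (map_ofNat _ 2).symm,
      smul_algebraMap]
  have hpm : ∀ g : absoluteGaloisGroup ℚ, g • t = t ∨ g • t = -t := fun g =>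
    eq_or_eq_neg_of_sq_eq_sq _ _ (by rw [← smul_pow', ht2', h2fix])
  refine ⟨t, ht2', htfix, ?_⟩
  rcases smul_eq_self_or_smul_eq_neg_of_layer_one κ htfix hpm with hall | hneg
  · exfalso
    obtain ⟨q, hq⟩ := exists_ratCast_eq_of_forall_smul_eq hall
    have hqq : ((q * q : ℚ) : AlgebraicClosure ℚ) = ((2 : ℚ) : AlgebraicClosure ℚ) := by
      push_cast
      rw [hq, ← pow_two, ht2']
    have h2sq : IsSquare (2 * ((1 : ℤ) : ℚ)) := ⟨q, by push_cast; exact_mod_cast hqq.symm⟩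
    exact not_isSquare_two_mul_intCast_of_odd odd_one h2sq
  · exact hneg

end LayerOne

/-! ## §2 Rubin's `τ` at `2`: a transposition of `E[2]` in `ker κ` fixing `√−1` -/

section Tau

variable (W : WeierstrassCurve ℚ) [W.IsElliptic] (κ : ZpExtension ℚ 2)

/-- **Rubin's `τ` at `p = 2`.** Let `W/ℚ` be elliptic with `ρ̄_{W,2}` onto, `2Δ ∉ ℚ^{×2}`, `−Δ ∉ ℚ^{×2}`,
`−2Δ ∉ ℚ^{×2}`, `κ` the CYCLOTOMIC `ℤ₂`-extension and `i ∈ ℚ̄` with `i² = −1`. Then some `τ ∈ ker κ = Gal(ℚ̄/ℚ_∞)` is a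
transposition on `E[2]` and fixes `i` — i.e. `τ ∈ Gal(ℚ̄/ℚ(μ_{2^∞}))` with `T₂W/(τ − 1)` free of rank one modulo `2`
(Rubin's `Hyp(ℚ_∞, T₂W)` (b); W_K2 Lemma 2.1 (d)). Proof: p681344 gives an odd `τ₀ ∈ ker κ`; if every odd element of
`ker κ` negated `i`, then `g(i)/i = sgn ρ̄₂(g)` on `ker κ`, hence on `Gal(ℚ̄/ℚ_1) = ker κ·Γ_ℚ²`, so `iδ` (`δ = √(Δ/16)`) is
fixed by `Gal(ℚ̄/ℚ_1)`; by §1 either `iδ ∈ ℚ` (`−Δ = (4iδ)²`) or `iδ` and `√2` are both negated off `Gal(ℚ̄/ℚ_1)`, making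
`iδ√2 ∈ ℚ` (`−2Δ = (4iδ√2)²`). [cite: Rubin2000, §2.1 (Hyp(K_∞, T)) and Thm. 2.3.3] [cite: DokchitserDokchitserMathZ2012, Theorem (2)] -/
theorem exists_mem_kerSubgroup_transposition_smul_sqrt_neg_one_eq (hκ : κ.IsCyclotomic)
    (h2 : W.HasSurjectiveModNGaloisRep 2) (h2Δ : ¬ IsSquare (2 * W.Δ)) (hnΔ : ¬ IsSquare (-W.Δ))
    (hn2Δ : ¬ IsSquare (-2 * W.Δ)) {i : AlgebraicClosure ℚ} (hi : i ^ 2 = -1) :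
    ∃ τ ∈ κ.kerSubgroup, Equiv.Perm.sign (permGal W (two_ne_zero : (2 : ℚ) ≠ 0) τ) = -1 ∧ τ • i = i := by
  have h2Q : (2 : ℚ) ≠ 0 := two_ne_zero
  obtain ⟨τ₀, hτ₀κ, hτ₀s⟩ := exists_mem_kerSubgroup_sign_permGal_eq_neg_one_of_isCyclotomic W κ hκ h2 h2Δ
  -- every Galois element moves `i` to `± i`
  have hpm : ∀ g : absoluteGaloisGroup ℚ, g • i = i ∨ g • i = -i := fun g =>
    eq_or_eq_neg_of_sq_eq_sq _ _ (by rw [← smul_pow', hi, smul_neg, smul_one])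
  by_contra hcon
  push Not at hcon
  have hA : ∀ τ ∈ κ.kerSubgroup, Equiv.Perm.sign (permGal W h2Q τ) = -1 → τ • i = -i :=
    fun τ hτ hs => (hpm τ).resolve_left (hcon τ hτ hs)
  have hτ₀i : τ₀ • i = -i := hA τ₀ hτ₀κ hτ₀s
  -- on `ker κ` the even elements fix `i`
  have hB : ∀ σ ∈ κ.kerSubgroup, Equiv.Perm.sign (permGal W h2Q σ) = 1 → σ • i = i := by
    intro σ hσ hs
    have hodd : Equiv.Perm.sign (permGal W h2Q (σ * τ₀)) = -1 := by
      rw [permGal_mul, map_mul, hs, hτ₀s, one_mul]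
    have h := hA (σ * τ₀) (κ.kerSubgroup.mul_mem hσ hτ₀κ) hodd
    rwa [mul_smul, hτ₀i, smul_neg, neg_inj] at h
  -- hence `x₁ = i δ` is fixed by the first layer `ker κ · Γ_ℚ²`
  have hx₁L : ∀ g ∈ κ.layerSubgroup 1, g • (i * delta W h2Q) = i * delta W h2Q := by
    intro g hg
    obtain ⟨τ, hτ, ρ, rfl⟩ := exists_mem_kerSubgroup_mul_sq_of_mem_layerSubgroup_one κ hg
    have hρρi : (ρ * ρ) • i = i := by
      rcases hpm ρ with h | h
      · rw [mul_smul, h, h]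
      · rw [mul_smul, h, smul_neg, h, neg_neg]
    have hρρs : Equiv.Perm.sign (permGal W h2Q (ρ * ρ)) = 1 := by
      rw [permGal_mul, map_mul, Int.units_mul_self]
    rw [smul_mul', smul_delta, permGal_mul, map_mul, hρρs, mul_one, mul_smul τ (ρ * ρ) i, hρρi]
    rcases Int.units_eq_one_or (Equiv.Perm.sign (permGal W h2Q τ)) with hs | hs
    · rw [hs, hB τ hτ hs, Units.val_one, Int.cast_one, one_mul]
    · rw [hs, hA τ hτ hs, Units.val_neg, Units.val_one, Int.cast_neg, Int.cast_one]
      ring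
  have hx₁pm : ∀ g : absoluteGaloisGroup ℚ,
      g • (i * delta W h2Q) = i * delta W h2Q ∨ g • (i * delta W h2Q) = -(i * delta W h2Q) := by
    intro g
    rw [smul_mul', smul_delta]
    rcases hpm g with h | h <;>
      rcases Int.units_eq_one_or (Equiv.Perm.sign (permGal W h2Q g)) with hs | hs <;>
        rw [h, hs] <;> simp
  have hΔ' := algebraMap_Δ W h2Q
  rw [eq_ratCast] at hΔ'
  rcases smul_eq_self_or_smul_eq_neg_of_layer_one κ hx₁L hx₁pm with hfix | hneg
  · -- `i δ ∈ ℚ`: `−Δ = (4 i δ)²`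
    obtain ⟨q, hq⟩ := exists_ratCast_eq_of_forall_smul_eq hfix
    apply hnΔ
    refine ⟨4 * q, ?_⟩
    have hqq : (((4 * q) * (4 * q) : ℚ) : AlgebraicClosure ℚ) = ((-W.Δ : ℚ) : AlgebraicClosure ℚ) := by
      push_cast
      rw [hq, hΔ']
      linear_combination ((16 : AlgebraicClosure ℚ) * delta W h2Q ^ 2) * hi
    exact_mod_cast hqq.symm
  · -- `i δ` and `√2` are both negated off the first layer: `i δ √2 ∈ ℚ`, `−2Δ = (4 i δ √2)²`
    obtain ⟨t, ht2, htL, htneg⟩ := exists_sqrt_two_smul_eq_neg_of_isCyclotomic κ hκ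
    have hfix : ∀ g : absoluteGaloisGroup ℚ, g • (i * delta W h2Q * t) = i * delta W h2Q * t := by
      intro g
      by_cases hg : g ∈ κ.layerSubgroup 1
      · rw [smul_mul', hx₁L g hg, htL g hg]
      · rw [smul_mul', hneg g hg, htneg g hg]
        ring
    obtain ⟨q, hq⟩ := exists_ratCast_eq_of_forall_smul_eq hfix
    apply hn2Δ
    refine ⟨4 * q, ?_⟩
    have hqq : (((4 * q) * (4 * q) : ℚ) : AlgebraicClosure ℚ) = ((-2 * W.Δ : ℚ) : AlgebraicClosure ℚ) := by
      push_cast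
      rw [hq, hΔ']
      linear_combination ((16 : AlgebraicClosure ℚ) * delta W h2Q ^ 2 * t ^ 2) * hi +
        (-(16 : AlgebraicClosure ℚ) * delta W h2Q ^ 2) * ht2
    exact_mod_cast hqq.symm

/-- **Rubin's `τ` at `2` on B8's habitat**: for a globally minimal `W`, good ordinary at `2` (so `Δ` is odd and
`±2Δ ∉ ℚ^{×2}`), with `ρ̄_{W,4}` onto (⇔ `ρ̄₂` onto and `−Δ ∉ ℚ^{×2}` at a good ordinary `2`; level `2` of
`X5.O1.TwoAdicSurjective W`), the cyclotomic `κ` and `i² = −1`: some `τ ∈ ker κ` is a transposition on `E[2]` fixing `i`.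
[cite: Rubin2000, §2.1 (Hyp(K_∞, T))] [cite: DokchitserDokchitserMathZ2012, Theorem (2)–(3)] -/
theorem exists_mem_kerSubgroup_transposition_smul_sqrt_neg_one_eq_of_goodOrd [W.IsGloballyMinimal]
    (hκ : κ.IsCyclotomic) (hgo : Rank1Residual.GoodOrd W 2) (h4 : W.HasSurjectiveModNGaloisRep 4)
    {i : AlgebraicClosure ℚ} (hi : i ^ 2 = -1) :
    ∃ τ ∈ κ.kerSubgroup, Equiv.Perm.sign (permGal W (two_ne_zero : (2 : ℚ) ≠ 0) τ) = -1 ∧ τ • i = i := by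
  obtain ⟨h2, hnΔ⟩ := (hasSurjectiveModNGaloisRep_four_iff_of_goodOrd_two W hgo).mp h4
  obtain ⟨h2Δ, hn2Δ⟩ := not_isSquare_two_mul_Δ_of_good_two W hgo.1
  exact exists_mem_kerSubgroup_transposition_smul_sqrt_neg_one_eq W κ hκ h2 h2Δ hnΔ hn2Δ hi

end Tau

end Summit.BirchSwinnertonDyer.BirchSwinnertonDyer.Theorems.SteinbergFibreAtTwo

end
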